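import Summits.HodgeConjecture.HodgeConjecture.Theorems.F0P3SpectralPacketHLaws   -- ★ (N) FILE 3o p843946∕…: `SpectralPacketH.CharIdentityψ` (+ its `.hchar`), `isLocSmooth_toPureTensor_loc`; ★ 3h `trPktH`∕`endoTrPkt`, ★ 3k `toPureTensor`
import HarnessLib

/-!
# (N) DEFS, FILE 3o-S — THE SIGNED FINITE-PLACE LAW (KT2″) `SpectralPacketH.CharIdentityψS … s`: the endoscopic character identities of `ρ` on `G′_v` through `ψ_v`
# WITH A PLACE-WISE SIGN `s v` ON THE ENDOSCOPIC SIDE (Rogawski §14.6 pp. 242–244 «`Δ′_v = c_v Δ″_v`, `c = ∏ c_v`»; Thm. 13.1.1 (2), Prop. 13.1.4 at the tree's `Δ‴_v = ε_v(H)·Δ_v∘ψ_v`)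

Cell `hodgecm-mathlib` (D-0151), F0∕P3c line LH7 (closer stub `stub_PKtuple`, row #181), crux H413 (`stmt-HodgeConjecture-24833`); seat LH7-p02 (g0) on LEAD F0P3a-plan (g13)
T12-13 «K2″» (= repair (R-b) of FLAG F10, LH7-p01 (g0) memo `MEMO-KG1-signed-pairing.v1.md` 584ab27dc5661f71; desk F0P3-plan (g13) PRE-PRICE §6; census LH7-p02
`CENSUS-TB-KG1-sign-consumption.v1.md` a05466b2c9f26d90).  DEF LANE (`--kind definition`, `--supports stmt-HodgeConjecture-24833 --as helper`): ONE `Prop`-valued predicate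
on GIVEN data with explicit binders + its `Iff.rfl` unfolding + two one-line comparison lemmas + the pinned-pair read-back; no instance, no notation, no named fact, no `sorry`;
★ `CharIdentityψ` is NOT edited (supersede-not-edit).  THIS FILE ASSERTS NOTHING.
HONEST LABEL: HC_CM is proved only modulo the 7 printed citations (2 remaining: hLiu418 = stmt-HodgeConjecture-24832, h413 = stmt-HodgeConjecture-24833) until rung 0 closes; #181
is under meaning flag F10 until the desk's ED. 3; this file proves no printed statement.

WHY (F10 ∕ K2″).  The (N) tuple letter binds ONE kit pairing `𝔩.pair`, read CANONICALLY by (KG1) ★ `UnramLaw` («`⟨ρ_v, π_v⁰⟩ = 1`», p. 203 l. 1) and, through (KT2) ★ `CharIdentityψ`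
at the pinned factor `𝔨.Δ = Δ‴` (★ `finExplicitCollection`: `Δ‴_v = ε_v(H) · Δ_v ∘ ψ_v`, ★ `CharIdentityOnTestFunctionsSigned` header) together with the letter's signed package
`hQ : CMCharIdentityPackageTestSigned`, WITH THE FORM SIGN `ε_v(H)` — two normalisations of `⟨ρ, π⟩` in one ∃, jointly unsatisfiable at frames with a finite `ε_v(H) = −1`.  Print keeps
the pairing canonical and carries the discrepancy of the fixed transfer factors OUTSIDE it: «`Tr(ρ_v(f′^H_v)) = −c_v ⟨ρ_v, π′_v⟩ Tr(π′_v(f′_v))`», `Δ′_v = c_v Δ″_v`, `c = ∏ c_v` [Rogawski1990 §14.6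
pp. 242–244].  K2″ (LEAD T12-13) does the same: `pair` and the packet signs stay canonical and the form sign enters EXACTLY ONE kit law — this one — as a place-wise factor
`s v ∈ ℤ` on the endoscopic side (the letter instantiates `s := formSignAt L H`, LH7-p01's Δ1; this file is generic in `s`).

CONTENTS (namespace `…Cruxes.H413.F0P3SpectralPacket`, next to ★ FILE 3o):
* §1 **`SpectralPacketH.CharIdentityψS ρ ψ νG′ νH Δ′ mH mG′ s : Prop`** := ★ `CharIdentityψ`'s text VERBATIM with the right-hand side `endoTrPkt …` multiplied by `(s v : ℂ)`;
  `charIdentityψS_iff` (`Iff.rfl`); `charIdentityψS_one_iff` (`s ≡ 1` ⇔ ★ `CharIdentityψ`); `CharIdentityψ.charIdentityψS_one` (the unsigned law is the signed law at `s ≡ 1`).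
* §2 **`CharIdentityψS.hchar`** — twin of ★ `CharIdentityψ.hchar`: the law at the pinned pair `(T^H_v, (f′_{S,∞} ⊗ f^S)_v)` reads `Tr ρ_v(T^H_v) = s_v · Σ_{π ∈ ξ_H(ρ_v)} ⟨ρ_v, π⟩ Tr π(… ∘ ψ_v⁻¹)`.
Consumers (HOME-first, same seat): the signed twins of ★ `trH_partner_eq_trHSψ_mul_prod_of_eval_eq_off` ∕ ★ `trH_partner_eq_zero_of_not_ramFinsetH_subset_of_eval_eq` ∕ ★
`factorisationPk_kitOfRecord_homOn`, where every finite place contributes its `s_v` and the (P1)-H factorisation carries the frame constant `σ = ∏_v s_v`.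

References: [Rogawski1990] §13.1 Thm. 13.1.1 (2) p. 198, Prop. 13.1.4 p. 199; §14.3 p. 233; §14.6 p. 237 l. −8, pp. 242–244 (`c_v`, `c = ∏ c_v`), p. 243 l. 9–17; §4.9 p. 55;
[LanglandsShelstad1987] §1 (the `κ`-sign), §6 (product formula).
-/

set_option autoImplicit false
-- the mandated namespace repeats `HodgeConjecture.HodgeConjecture`, as in every `Theorems/*.lean` of this sub-problem
set_option linter.dupNamespace false

noncomputable section

open NumberField IsDedekindDomain MeasureTheory Filter
open scoped Matrix MatrixGroups

open Literature.NumberTheory Literature.NumberTheory.Automorphic Literature.NumberTheory.Automorphic.UnitaryGroup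
open Literature.NumberTheory.Rogawski1990 Literature.NumberTheory.GaloisRepresentations
open Summit.HodgeConjecture.HodgeConjecture.Cruxes.H413.F0P3InnerFormClassificationV6 (TestH splitForm)
open Summit.HodgeConjecture.HodgeConjecture.Cruxes.H413.F0P3LocalPacketKit
open Summit.HodgeConjecture.HodgeConjecture.Cruxes.H413.F0P3ArchPacketKit
open Summit.HodgeConjecture.HodgeConjecture.Cruxes.H413.F0P3SemilocalTestFunctionsOfRecord (TestS₀ toPureTensor locAll isLocallyConstant_hasCompactSupport_locAll)
open Summit.HodgeConjecture.HodgeConjecture.Cruxes.H413.F0P3TestFunctionsOfRecord (Unr₀)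

namespace Summit.HodgeConjecture.HodgeConjecture.Cruxes.H413.F0P3SpectralPacket

open Summit.HodgeConjecture.HodgeConjecture.Cruxes.H413.F0P3GlobalPacket
open Summit.HodgeConjecture.HodgeConjecture.Cruxes.H413.F0P3ArchPacketKit.ArchPacketKitH

variable {L : Type} [Field L] [NumberField L] [IsCMField L] {H : Matrix (Fin 3) (Fin 3) L} {ι : L →+* ℂ} {T : GL (Fin 3) ℂ}
  {hT : (T : Matrix (Fin 3) (Fin 3) ℂ)ᴴ * H.map ι * (T : Matrix (Fin 3) (Fin 3) ℂ) = Literature.Geometry.ComplexHyperbolic.BallModel.J}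
  {𝔩 : ∀ v : HeightOneSpectrum (𝓞 ↥(maximalRealSubfield L)), LocalPacketKit L (splitForm L 3) v} {𝔞 : ArchPacketKit} {𝔞H : ArchPacketKitH 𝔞}
  {DiscH : GlobalPacketH 𝔩 → 𝔞H.PktInfH → Prop}

/-! ## §1 (KT2″) The signed finite-place law [Thm. 13.1.1 (2); Prop. 13.1.4; §14.6 pp. 242–244 `c_v`] -/

namespace SpectralPacketH

/-- **(KT2″) `ρ.CharIdentityψS ψ νG′ νH Δ′ mH mG′ s` — «THE LOCAL COMPONENTS OF `ρ` OBEY THE ENDOSCOPIC CHARACTER IDENTITIES AGAINST THE `Δ′_v`-TRANSFER ON `G′_v`, READ THROUGH `ψ_v`,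
UP TO THE PLACE-WISE SIGN `s_v`»**: at every finite `v`, for every `Δ′_v`-matching pair of TEST functions `(f^H, f′)` on `H_v` and `G′_v = U(H)(L⁺_v)` (★ `IsLocSmooth`, ★
`IsLocalDeltaTransfer L H v (Δ′ v) (mH v) (mG′ v)`), `Σ_{σ ∈ ρ_v} Tr σ(f^H) = s_v · Σ_{π ∈ ξ_H(ρ_v)} ⟨ρ_v, π⟩ Tr π(f′ ∘ ψ_v⁻¹; ψ_{v*} νG′_v)` (★ FILE 1 `trPktH`, ★ FILE 3h `endoTrPkt`)
— ★ `CharIdentityψ`'s text with the endoscopic side multiplied by `(s v : ℂ)`.  Print: Thm. 13.1.1 (2) ∕ Prop. 13.1.4 state the identity with the CANONICAL pairing for print's `Δ_v`;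
for an inner form the fixed local factors differ from the transported ones by signs `c_v` with `c = ∏ c_v`, carried OUTSIDE the pairing (p. 242 «`Δ′_v = c_v Δ″_v`», p. 244
«`Tr(ρ_v(f′^H_v)) = −c_v⟨ρ_v, π′_v⟩Tr(π′_v(f′_v))`»); at the tree's `Δ‴_v = ε_v(H)·Δ_v∘ψ_v` the intended value is `s v = ε_v(H)` (`= formSignAt L H v`, the closed sign of ★
`CMCharIdentityPackageTestSigned`'s clause).  The (KT2″) row of `TupleKitLawsK2` (T-A ED. 3 «K2″»).  A PREDICATE; asserts nothing.
[cite: Rogawski1990, §13.1 Thm. 13.1.1 (2) p. 198, Prop. 13.1.4 p. 199; §14.6 pp. 242–244, p. 237 l. −8; §14.3 p. 233] [cite: LanglandsShelstad1987, §1] -/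
def CharIdentityψS (ρ : SpectralPacketH 𝔩 𝔞 𝔞H DiscH)
    (ψ : ∀ v : HeightOneSpectrum (𝓞 ↥(maximalRealSubfield L)), (cmDatum L 3 H).Local v ≃ₜ* (cmDatum L 3 (splitForm L 3)).Local v)
    [∀ v : HeightOneSpectrum (𝓞 ↥(maximalRealSubfield L)), MeasurableSpace ((cmDatum L 3 (splitForm L 3)).Local v)] [∀ v : HeightOneSpectrum (𝓞 ↥(maximalRealSubfield L)), MeasurableSpace ((cmDatum L 3 H).Local v)]
    [∀ v : HeightOneSpectrum (𝓞 ↥(maximalRealSubfield L)), MeasurableSpace ((cmDatum L 2 (splitForm L 2)).Local v × (cmDatum L 1 (splitForm L 1)).Local v)]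
    (νG' : ∀ v : HeightOneSpectrum (𝓞 ↥(maximalRealSubfield L)), Measure ((cmDatum L 3 H).Local v)) (νH : ∀ v : HeightOneSpectrum (𝓞 ↥(maximalRealSubfield L)), Measure ((cmDatum L 2 (splitForm L 2)).Local v × (cmDatum L 1 (splitForm L 1)).Local v))
    (Δ' : ∀ v : HeightOneSpectrum (𝓞 ↥(maximalRealSubfield L)), LocalTransferFactor L H v)
    (mH : letI : ∀ (v : HeightOneSpectrum (𝓞 ↥(maximalRealSubfield L))) (a : (cmDatum L 2 (splitForm L 2)).Local v × (cmDatum L 1 (splitForm L 1)).Local v), MeasurableSpace (((cmDatum L 2 (splitForm L 2)).Local v × (cmDatum L 1 (splitForm L 1)).Local v) ⧸ Subgroup.centralizer ({a} : Set ((cmDatum L 2 (splitForm L 2)).Local v × (cmDatum L 1 (splitForm L 1)).Local v))) := fun _ _ => borel _;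
      ∀ v : HeightOneSpectrum (𝓞 ↥(maximalRealSubfield L)), OrbitalMeasureFamily ((cmDatum L 2 (splitForm L 2)).Local v × (cmDatum L 1 (splitForm L 1)).Local v))
    (mG' : letI : ∀ (v : HeightOneSpectrum (𝓞 ↥(maximalRealSubfield L))) (γ : (cmDatum L 3 H).Local v), MeasurableSpace ((cmDatum L 3 H).Local v ⧸ Subgroup.centralizer ({γ} : Set ((cmDatum L 3 H).Local v))) := fun _ _ => borel _;
      ∀ v : HeightOneSpectrum (𝓞 ↥(maximalRealSubfield L)), OrbitalMeasureFamily ((cmDatum L 3 H).Local v))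
    (s : HeightOneSpectrum (𝓞 ↥(maximalRealSubfield L)) → ℤ) : Prop :=
  letI : ∀ (v : HeightOneSpectrum (𝓞 ↥(maximalRealSubfield L))) (a : (cmDatum L 2 (splitForm L 2)).Local v × (cmDatum L 1 (splitForm L 1)).Local v), MeasurableSpace (((cmDatum L 2 (splitForm L 2)).Local v × (cmDatum L 1 (splitForm L 1)).Local v) ⧸ Subgroup.centralizer ({a} : Set ((cmDatum L 2 (splitForm L 2)).Local v × (cmDatum L 1 (splitForm L 1)).Local v))) := fun _ _ => borel _
  letI : ∀ (v : HeightOneSpectrum (𝓞 ↥(maximalRealSubfield L))) (γ : (cmDatum L 3 H).Local v), MeasurableSpace ((cmDatum L 3 H).Local v ⧸ Subgroup.centralizer ({γ} : Set ((cmDatum L 3 H).Local v))) := fun _ _ => borel _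
  ∀ (v : HeightOneSpectrum (𝓞 ↥(maximalRealSubfield L))) (fH : (cmDatum L 2 (splitForm L 2)).Local v × (cmDatum L 1 (splitForm L 1)).Local v → ℂ) (f' : (cmDatum L 3 H).Local v → ℂ),
    IsLocSmooth fH → IsLocSmooth f' → IsLocalDeltaTransfer L H v (Δ' v) (mH v) (mG' v) fH f' →
      (𝔩 v).trPktH (νH v) (ρ.fin.loc v) fH = (s v : ℂ) * (𝔩 v).endoTrPkt ((νG' v).map (ψ v)) (ρ.fin.loc v) (f' ∘ (ψ v).symm)

section Unfold

variable {ρ : SpectralPacketH 𝔩 𝔞 𝔞H DiscH}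
  {ψ : ∀ v : HeightOneSpectrum (𝓞 ↥(maximalRealSubfield L)), (cmDatum L 3 H).Local v ≃ₜ* (cmDatum L 3 (splitForm L 3)).Local v}
  [∀ v : HeightOneSpectrum (𝓞 ↥(maximalRealSubfield L)), MeasurableSpace ((cmDatum L 3 (splitForm L 3)).Local v)] [∀ v : HeightOneSpectrum (𝓞 ↥(maximalRealSubfield L)), MeasurableSpace ((cmDatum L 3 H).Local v)]
  [∀ v : HeightOneSpectrum (𝓞 ↥(maximalRealSubfield L)), MeasurableSpace ((cmDatum L 2 (splitForm L 2)).Local v × (cmDatum L 1 (splitForm L 1)).Local v)]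
  {νG' : ∀ v : HeightOneSpectrum (𝓞 ↥(maximalRealSubfield L)), Measure ((cmDatum L 3 H).Local v)} {νH : ∀ v : HeightOneSpectrum (𝓞 ↥(maximalRealSubfield L)), Measure ((cmDatum L 2 (splitForm L 2)).Local v × (cmDatum L 1 (splitForm L 1)).Local v)}
  {Δ' : ∀ v : HeightOneSpectrum (𝓞 ↥(maximalRealSubfield L)), LocalTransferFactor L H v}
  {mH : letI : ∀ (v : HeightOneSpectrum (𝓞 ↥(maximalRealSubfield L))) (a : (cmDatum L 2 (splitForm L 2)).Local v × (cmDatum L 1 (splitForm L 1)).Local v), MeasurableSpace (((cmDatum L 2 (splitForm L 2)).Local v × (cmDatum L 1 (splitForm L 1)).Local v) ⧸ Subgroup.centralizer ({a} : Set ((cmDatum L 2 (splitForm L 2)).Local v × (cmDatum L 1 (splitForm L 1)).Local v))) := fun _ _ => borel _;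
      ∀ v : HeightOneSpectrum (𝓞 ↥(maximalRealSubfield L)), OrbitalMeasureFamily ((cmDatum L 2 (splitForm L 2)).Local v × (cmDatum L 1 (splitForm L 1)).Local v)}
  {mG' : letI : ∀ (v : HeightOneSpectrum (𝓞 ↥(maximalRealSubfield L))) (γ : (cmDatum L 3 H).Local v), MeasurableSpace ((cmDatum L 3 H).Local v ⧸ Subgroup.centralizer ({γ} : Set ((cmDatum L 3 H).Local v))) := fun _ _ => borel _;
      ∀ v : HeightOneSpectrum (𝓞 ↥(maximalRealSubfield L)), OrbitalMeasureFamily ((cmDatum L 3 H).Local v)}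
  {s : HeightOneSpectrum (𝓞 ↥(maximalRealSubfield L)) → ℤ}

/-- Unfolding of (KT2″) (`Iff.rfl`). [cite: Rogawski1990, §13.1 Thm. 13.1.1 (2) p. 198; §14.6 pp. 242–244] -/
theorem charIdentityψS_iff :
    ρ.CharIdentityψS ψ νG' νH Δ' mH mG' s ↔
  letI : ∀ (v : HeightOneSpectrum (𝓞 ↥(maximalRealSubfield L))) (a : (cmDatum L 2 (splitForm L 2)).Local v × (cmDatum L 1 (splitForm L 1)).Local v), MeasurableSpace (((cmDatum L 2 (splitForm L 2)).Local v × (cmDatum L 1 (splitForm L 1)).Local v) ⧸ Subgroup.centralizer ({a} : Set ((cmDatum L 2 (splitForm L 2)).Local v × (cmDatum L 1 (splitForm L 1)).Local v))) := fun _ _ => borel _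
  letI : ∀ (v : HeightOneSpectrum (𝓞 ↥(maximalRealSubfield L))) (γ : (cmDatum L 3 H).Local v), MeasurableSpace ((cmDatum L 3 H).Local v ⧸ Subgroup.centralizer ({γ} : Set ((cmDatum L 3 H).Local v))) := fun _ _ => borel _
  ∀ (v : HeightOneSpectrum (𝓞 ↥(maximalRealSubfield L))) (fH : (cmDatum L 2 (splitForm L 2)).Local v × (cmDatum L 1 (splitForm L 1)).Local v → ℂ) (f' : (cmDatum L 3 H).Local v → ℂ),
    IsLocSmooth fH → IsLocSmooth f' → IsLocalDeltaTransfer L H v (Δ' v) (mH v) (mG' v) fH f' →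
      (𝔩 v).trPktH (νH v) (ρ.fin.loc v) fH = (s v : ℂ) * (𝔩 v).endoTrPkt ((νG' v).map (ψ v)) (ρ.fin.loc v) (f' ∘ (ψ v).symm) :=
  Iff.rfl

/-- **At `s ≡ 1` the signed law IS ★ `CharIdentityψ`** (`one_mul`). [cite: Rogawski1990, §13.1 Thm. 13.1.1 (2) p. 198, Prop. 13.1.4 p. 199] -/
theorem charIdentityψS_one_iff :
    ρ.CharIdentityψS ψ νG' νH Δ' mH mG' (fun _ => 1) ↔ ρ.CharIdentityψ ψ νG' νH Δ' mH mG' := by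
  refine ⟨fun h v fH f' hfH hf' hm => ?_, fun h v fH f' hfH hf' hm => ?_⟩
  · have e := h v fH f' hfH hf' hm
    rwa [Int.cast_one, one_mul] at e
  · rw [Int.cast_one, one_mul]
    exact h v fH f' hfH hf' hm

/-- The unsigned law ★ `CharIdentityψ` gives the signed law at `s ≡ 1`. [cite: Rogawski1990, §13.1 Thm. 13.1.1 (2) p. 198] -/
theorem CharIdentityψ.charIdentityψS_one (h : ρ.CharIdentityψ ψ νG' νH Δ' mH mG') :
    ρ.CharIdentityψS ψ νG' νH Δ' mH mG' (fun _ => 1) :=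
  charIdentityψS_one_iff.2 h

end Unfold

/-! ## §2 (KT2″) at the pinned pair [Thm. 13.1.1 (2); §14.3 p. 233] -/

/-- **THE SIGNED LAW AT THE PINNED PAIR** (twin of ★ `CharIdentityψ.hchar`): for an unramified₂ pair tensor `T^H` with `C_c^∞` factors, `Δ′_v`-matched to the factors of `f′_{S,∞} ⊗ f^S` at
every `v`, `Tr ρ_v(T^H_v) = s_v · Σ_{π ∈ ξ_H(ρ_v)} ⟨ρ_v, π⟩ Tr π((f′_{S,∞} ⊗ f^S)_v ∘ ψ_v⁻¹)`. [cite: Rogawski1990, §13.1 Thm. 13.1.1 (2) p. 198; §14.3 p. 233; §14.6 pp. 242–244] -/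
theorem CharIdentityψS.hchar {ρ : SpectralPacketH 𝔩 𝔞 𝔞H DiscH}
    {ψ : ∀ v : HeightOneSpectrum (𝓞 ↥(maximalRealSubfield L)), (cmDatum L 3 H).Local v ≃ₜ* (cmDatum L 3 (splitForm L 3)).Local v}
    [∀ v : HeightOneSpectrum (𝓞 ↥(maximalRealSubfield L)), MeasurableSpace ((cmDatum L 3 (splitForm L 3)).Local v)] [∀ v : HeightOneSpectrum (𝓞 ↥(maximalRealSubfield L)), MeasurableSpace ((cmDatum L 3 H).Local v)]
    [∀ v : HeightOneSpectrum (𝓞 ↥(maximalRealSubfield L)), MeasurableSpace ((cmDatum L 2 (splitForm L 2)).Local v × (cmDatum L 1 (splitForm L 1)).Local v)]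
    {νG' : ∀ v : HeightOneSpectrum (𝓞 ↥(maximalRealSubfield L)), Measure ((cmDatum L 3 H).Local v)} {νH : ∀ v : HeightOneSpectrum (𝓞 ↥(maximalRealSubfield L)), Measure ((cmDatum L 2 (splitForm L 2)).Local v × (cmDatum L 1 (splitForm L 1)).Local v)}
    {Δ' : ∀ v : HeightOneSpectrum (𝓞 ↥(maximalRealSubfield L)), LocalTransferFactor L H v}
    {mH : letI : ∀ (v : HeightOneSpectrum (𝓞 ↥(maximalRealSubfield L))) (a : (cmDatum L 2 (splitForm L 2)).Local v × (cmDatum L 1 (splitForm L 1)).Local v), MeasurableSpace (((cmDatum L 2 (splitForm L 2)).Local v × (cmDatum L 1 (splitForm L 1)).Local v) ⧸ Subgroup.centralizer ({a} : Set ((cmDatum L 2 (splitForm L 2)).Local v × (cmDatum L 1 (splitForm L 1)).Local v))) := fun _ _ => borel _;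
      ∀ v : HeightOneSpectrum (𝓞 ↥(maximalRealSubfield L)), OrbitalMeasureFamily ((cmDatum L 2 (splitForm L 2)).Local v × (cmDatum L 1 (splitForm L 1)).Local v)}
    {mG' : letI : ∀ (v : HeightOneSpectrum (𝓞 ↥(maximalRealSubfield L))) (γ : (cmDatum L 3 H).Local v), MeasurableSpace ((cmDatum L 3 H).Local v ⧸ Subgroup.centralizer ({γ} : Set ((cmDatum L 3 H).Local v))) := fun _ _ => borel _;
      ∀ v : HeightOneSpectrum (𝓞 ↥(maximalRealSubfield L)), OrbitalMeasureFamily ((cmDatum L 3 H).Local v)}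
    {s : HeightOneSpectrum (𝓞 ↥(maximalRealSubfield L)) → ℤ}
    (hlaw : ρ.CharIdentityψS ψ νG' νH Δ' mH mG' s) (S : Finset (HeightOneSpectrum (𝓞 ↥(maximalRealSubfield L)))) (fS : TestS₀ L H ι T hT S) (fT : Unr₀ L H S)
    {TH : UnitaryGroup.PureTensor₂ L (splitForm L 2) (splitForm L 1)} (hsH : ∀ v : HeightOneSpectrum (𝓞 ↥(maximalRealSubfield L)), IsLocSmooth (TH.loc v))
    (hΔ : letI : ∀ (v : HeightOneSpectrum (𝓞 ↥(maximalRealSubfield L))) (a : (cmDatum L 2 (splitForm L 2)).Local v × (cmDatum L 1 (splitForm L 1)).Local v), MeasurableSpace (((cmDatum L 2 (splitForm L 2)).Local v × (cmDatum L 1 (splitForm L 1)).Local v) ⧸ Subgroup.centralizer ({a} : Set ((cmDatum L 2 (splitForm L 2)).Local v × (cmDatum L 1 (splitForm L 1)).Local v))) := fun _ _ => borel _;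
      letI : ∀ (v : HeightOneSpectrum (𝓞 ↥(maximalRealSubfield L))) (γ : (cmDatum L 3 H).Local v), MeasurableSpace ((cmDatum L 3 H).Local v ⧸ Subgroup.centralizer ({γ} : Set ((cmDatum L 3 H).Local v))) := fun _ _ => borel _;
      ∀ v : HeightOneSpectrum (𝓞 ↥(maximalRealSubfield L)), IsLocalDeltaTransfer L H v (Δ' v) (mH v) (mG' v) (TH.loc v) ((toPureTensor S fS fT).loc v)) (v : HeightOneSpectrum (𝓞 ↥(maximalRealSubfield L))) :
    (𝔩 v).trPktH (νH v) (ρ.fin.loc v) (TH.loc v) = (s v : ℂ) * (𝔩 v).endoTrPkt ((νG' v).map (ψ v)) (ρ.fin.loc v) ((toPureTensor S fS fT).loc v ∘ (ψ v).symm) :=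
  hlaw v _ _ (hsH v) (isLocSmooth_toPureTensor_loc S fS fT v) (hΔ v)

end SpectralPacketH

end Summit.HodgeConjecture.HodgeConjecture.Cruxes.H413.F0P3SpectralPacket

end
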